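import Literature.Probability.Percolation.KozmaNitzanClusterPropertyReal
import HarnessLib

/-!
# `NoHeavyLowerTail` (stmt-CriticalPhenomena-4575) — tools for pinned conditional association across a
# vertex separator: first entrance, finite disintegration, which pairs decide which events

Support file (`--supports stmt-CriticalPhenomena-4575`), lemma factory #7 (`prim-lf-7`, k-cluster conditional
association, gen 6).  No definitions, no named facts, no sorries.  Consumed by
`…NoHeavyLowerTailPinnedCA.lean` (the inequality
`μ(D_S) · μ(D_S ∩ {o ↔ S} ∩ {b ↔ S}) ≤ μ(D_S ∩ {o ↔ S}) · μ(D_S ∩ {b ↔ S})`, `D_S` = "no open `o–b` path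
avoiding `S`").

* `PinnedCA.first_entrance` — for `x ∉ S`: `x ↔ S` iff some `t` joined to `x` INSIDE `Sᶜ` has an open pair to
  `S` (cut an open path at its first visit to `S`).
* `PinnedCA.not_reachable_of_not_openConnIn_of_not_reachable` — `o ↮ b` off `a` and `o ↮ a` give `o ↮ b`.
* `PinnedCA.setIntegral_eq_sum_fibre`, `PinnedCA.real_eq_sum_fibre` — `∫_X g(φ ω) dμ = Σ_c μ(X ∩ φ⁻¹{c}) g(c)`
  for a map `φ` into a finite type (finite disintegration along the fibres).
* `PinnedCA.determinedBy_preimage_restrict` — the pull-back of an event of configurations on a vertex subset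
  `R` is decided by the pairs inside `R`; `PinnedCA.determinedBy_cross` — "some pair from `T` to `S` is open"
  is decided by those pairs; `PinnedCA.cross_disjoint_inside`, `PinnedCA.cross_disjoint_cross` — these sets
  of pairs are disjoint from the pairs inside `Sᶜ` and from each other for disjoint `T, T' ⊆ Sᶜ`
  (the supports needed for `prodBernoulli_real_inter_of_determinedBy`).
[cite: Grimmett1999, §1.3 p. 10 and §2.2 (product measure, events determined by finitely many edges)]
[cite: VandenbergHaggstromKahn2005, §1 p. 3 (events read off the open cluster)]
-/

namespace Summit.CriticalPhenomena.PercolationContinuityZ3.Theorems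

open MeasureTheory Set Literature.Probability.LatticeModels Literature.Probability.Percolation
open scoped Classical
open KNPreFKG

noncomputable section

namespace PinnedCA

variable {V : Type*}

/-! ### Path algebra: first entrance into `S` -/

/-- **First entrance.** For `x ∉ S`: `x` is joined to some vertex of `S` iff some vertex `t` joined to `x`
inside `Sᶜ` has an open pair to a vertex of `S` (cut an open path at its first visit to `S`). [folklore] -/
theorem first_entrance (S : Set V) {x : V} (hx : x ∉ S) (ω : BondConfig V) :
    (∃ s ∈ S, (openGraph ω).Reachable x s) ↔
      ∃ t, ω ∈ openConnIn Sᶜ x t ∧ ∃ s ∈ S, s(t, s) ∈ ω := by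
  constructor
  · rintro ⟨s, hs, ⟨p⟩⟩
    -- induction on the walk, keeping the start outside `S`
    suffices h : ∀ (u v : V) (q : (openGraph ω).Walk u v), u ∉ S → v ∈ S →
        ∃ t, ω ∈ openConnIn Sᶜ u t ∧ ∃ s ∈ S, s(t, s) ∈ ω from h x s p hx hs
    intro u v q
    induction q with
    | nil => exact fun hu hv => absurd hv hu
    | cons hadj q ih =>
      rename_i u u₁ v
      intro hu hv
      have h₁ : s(u, u₁) ∈ ω ∧ u ≠ u₁ := (openGraph_adj ω u u₁).1 hadj
      by_cases hu₁ : u₁ ∈ S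
      · exact ⟨u, openConnIn_rfl (show u ∈ Sᶜ from hu) ω, u₁, hu₁, h₁.1⟩
      · obtain ⟨t, ht, s', hs', hts'⟩ := ih hu₁ hv
        exact ⟨t, openConnIn_trans (openConnIn_of_adj (show u ∈ Sᶜ from hu) (show u₁ ∈ Sᶜ from hu₁) hadj) ht,
          s', hs', hts'⟩
  · rintro ⟨t, ht, s, hs, hts⟩
    have hts' : t ≠ s := fun h => (show t ∈ Sᶜ from ht.2.1) (h ▸ hs)
    exact ⟨s, hs, (reachable_of_openConnIn ht).trans
      (SimpleGraph.Adj.reachable ((openGraph_adj ω t s).2 ⟨hts, hts'⟩))⟩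

/-- If `o ↮ b` inside `{a}ᶜ` and `o ↮ a`, then `o ↮ b` (an open path from `o` to `b` either avoids `a` or
visits it). [folklore] -/
theorem not_reachable_of_not_openConnIn_of_not_reachable {ω : BondConfig V} {o a b : V}
    (hD : ω ∉ openConnIn ({a}ᶜ : Set V) o b) (hoa : ¬ (openGraph ω).Reachable o a) :
    ¬ (openGraph ω).Reachable o b := by
  intro hob
  -- walk along an open path from `o` to `b`; it must visit `a`
  have key : ∀ (u v : V) (q : (openGraph ω).Walk u v), u ≠ a →
      (openGraph ω).Reachable u a ∨ ω ∈ openConnIn ({a}ᶜ : Set V) u v := by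
    intro u v q
    induction q with
    | nil => exact fun hu => Or.inr (openConnIn_rfl (show _ ∈ ({a}ᶜ : Set V) from hu) ω)
    | cons hadj q ih =>
      rename_i u u₁ v
      intro hu
      by_cases hu₁ : u₁ = a
      · exact Or.inl (hu₁ ▸ hadj.reachable)
      · rcases ih hu₁ with h | h
        · exact Or.inl (hadj.reachable.trans h)
        · exact Or.inr (openConnIn_trans
            (openConnIn_of_adj (show u ∈ ({a}ᶜ : Set V) from hu) (show u₁ ∈ ({a}ᶜ : Set V) from hu₁) hadj) h)
  obtain ⟨p⟩ := hob
  have hoa' : o ≠ a := fun h => hoa (h ▸ SimpleGraph.Reachable.refl _)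
  rcases key o b p hoa' with h | h
  · exact hoa h
  · exact hD h

/-! ### Finite disintegration along a map into a finite type -/

section Fibre

variable {W κ : Type*} [Fintype W] [Fintype κ]

/-- `∫_X g(φ ω) dμ = Σ_c μ(X ∩ φ⁻¹{c}) · g(c)` for a map `φ` into a finite type. [folklore] -/
theorem setIntegral_eq_sum_fibre (μ : Measure (BondConfig W)) [IsFiniteMeasure μ]
    (φ : BondConfig W → κ) (g : κ → ℝ) (X : Set (BondConfig W)) :
    ∫ ω in X, g (φ ω) ∂μ = ∑ c, μ.real (X ∩ φ ⁻¹' {c}) * g c := by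
  have hfun : (fun ω => g (φ ω)) = fun ω => ∑ c, (φ ⁻¹' {c}).indicator (fun _ => g c) ω := by
    funext ω
    rw [Finset.sum_eq_single (φ ω)]
    · rw [indicator_of_mem (show ω ∈ φ ⁻¹' {φ ω} from rfl)]
    · intro c _ hc
      exact indicator_of_notMem (fun h : ω ∈ φ ⁻¹' {c} => hc (mem_singleton_iff.1 h).symm) _
    · exact fun h => absurd (Finset.mem_univ _) h
  rw [hfun, integral_finsetSum _ fun c _ => (Integrable.of_finite)]
  refine Finset.sum_congr rfl fun c _ => ?_
  rw [setIntegral_indicator (MeasurableSet.of_discrete), setIntegral_const, smul_eq_mul]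

/-- `μ(X) = Σ_c μ(X ∩ φ⁻¹{c})`. [folklore] -/
theorem real_eq_sum_fibre (μ : Measure (BondConfig W)) [IsFiniteMeasure μ]
    (φ : BondConfig W → κ) (X : Set (BondConfig W)) :
    μ.real X = ∑ c, μ.real (X ∩ φ ⁻¹' {c}) := by
  have h := setIntegral_eq_sum_fibre μ φ (fun _ => (1 : ℝ)) X
  simp only [mul_one, setIntegral_const, smul_eq_mul] at h
  exact h

end Fibre

/-! ### Which pairs decide which events -/

section Determined

/-- The pull-back of an event of configurations on `Sᶜ` is decided by the pairs inside `Sᶜ`. [folklore] -/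
theorem determinedBy_preimage_restrict (R : Set V) (E : Set (BondConfig ↥R)) :
    DeterminedBy (restrictConfig (Subtype.val : ↥R → V) ⁻¹' E)
      (Set.range (Sym2.map (Subtype.val : ↥R → V))) := by
  rw [determinedBy_iff]
  intro ω ω' h
  have key : restrictConfig (Subtype.val : ↥R → V) ω = restrictConfig (Subtype.val : ↥R → V) ω' := by
    ext e
    simp only [mem_restrictConfig]
    have he : Sym2.map Subtype.val e ∈ Set.range (Sym2.map (Subtype.val : ↥R → V)) := ⟨e, rfl⟩
    constructor
    · intro h1
      exact ((Set.ext_iff.1 h _).1 ⟨h1, he⟩).1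
    · intro h1
      exact ((Set.ext_iff.1 h _).2 ⟨h1, he⟩).1
  rw [mem_preimage, mem_preimage, key]

/-- The attachment event "some pair from `T` to `S` is open" is decided by those pairs. [folklore] -/
theorem determinedBy_cross (S : Set V) {R : Set V} (T : Finset ↥R) :
    DeterminedBy {ω : BondConfig V | ∃ t ∈ T, ∃ s ∈ S, s((t : V), s) ∈ ω}
      {e : Sym2 V | ∃ t ∈ T, ∃ s ∈ S, e = s((t : V), s)} := by
  rw [determinedBy_iff]
  intro ω ω' h
  simp only [mem_setOf_eq]
  refine exists_congr fun t => and_congr_right fun ht => exists_congr fun s => and_congr_right fun hs => ?_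
  have he : s((t : V), s) ∈ {e : Sym2 V | ∃ t ∈ T, ∃ s ∈ S, e = s((t : V), s)} := ⟨t, ht, s, hs, rfl⟩
  exact ⟨fun h1 => ((Set.ext_iff.1 h _).1 ⟨h1, he⟩).1, fun h1 => ((Set.ext_iff.1 h _).2 ⟨h1, he⟩).1⟩

/-- Pairs from `Sᶜ` to `S` are not pairs inside `Sᶜ`. [folklore] -/
theorem cross_disjoint_inside (S : Set V) (T : Finset ↥Sᶜ) :
    Disjoint {e : Sym2 V | ∃ t ∈ T, ∃ s ∈ S, e = s((t : V), s)}
      (Set.range (Sym2.map (Subtype.val : ↥Sᶜ → V))) := by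
  rw [Set.disjoint_left]
  rintro e ⟨t, -, s, hs, rfl⟩ ⟨e', he'⟩
  have hmem : s ∈ Sym2.map Subtype.val e' := by
    rw [he']
    exact Sym2.mem_mk_right _ _
  obtain ⟨a, -, ha⟩ := Sym2.mem_map.1 hmem
  exact a.2 (by rw [ha]; exact hs)

/-- Disjoint vertex sets off `S` have disjoint sets of pairs to `S`. [folklore] -/
theorem cross_disjoint_cross (S : Set V) {T T' : Finset ↥Sᶜ} (h : Disjoint T T') :
    Disjoint {e : Sym2 V | ∃ t ∈ T, ∃ s ∈ S, e = s((t : V), s)}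
      {e : Sym2 V | ∃ t ∈ T', ∃ s ∈ S, e = s((t : V), s)} := by
  rw [Set.disjoint_left]
  rintro e ⟨t, ht, s, hs, rfl⟩ ⟨t', ht', s', hs', he⟩
  rcases Sym2.eq_iff.1 he with ⟨htt', -⟩ | ⟨hts', -⟩
  · have htt : t = t' := Subtype.ext htt'
    subst htt
    exact Finset.disjoint_left.1 h ht ht'
  · exact t.2 (by rw [hts']; exact hs')

end Determined

end PinnedCA

end

end Summit.CriticalPhenomena.PercolationContinuityZ3.Theorems
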